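import Summits.KontsevichZagierPeriods.Zeta5Search.Barrier.ConeGammaLogCuspPeriods

/-!
# ζ(5) search — BARRIER: the LOG-CUSP SHAPE THEOREM — `Φ(s(a) + εδ) − Φ(s(a)) = (σ/T)·ε·log(1/ε) + O(ε)`

HONEST FRAMING (cell `pub-zeta5`): systematic search; no irrationality claim unless kernel-certified. MODEL objects
under Brown–Zudilin's (28)+(30) accounting ([BZ22] = arXiv:2210.03391); nothing here is a statement about `ζ(5)`,
about `γ`, or about the cone's supremum (C2 = `BarrierC2` stays OPEN; the lemma S-E stays CONJECTURED); records in
print UNMOVED. Prover P2 g19 (self-selected Lean-only item of the P2 lineage; sources: P2 g11 `SE-STRUCTURE.md` §3,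
lead/lit g27 `SE-DESK-NOTE.md` §2; builds on the theory seat's (P4) chain `ConeGammaShift*` of cert-2 g17).

Part 3/3. `BARRIER-PLAN.md` §2b listed «the log-cusp expansion of `Φ` itself (P2's Theorem §3)» as NOT in the
kernel; its two exact ingredients were (cert-2 g17): Lemma A `torusN_add_smul_of_germ` and Lemma B
`translateIntegral_shift_eq_slope`. This file proves the LEADING-ORDER expansion:

* **`phi30_logCusp`** — for a direction `a` of the closed box with all 28 forms positive, a period `T`
  (`T·h_k(a) ∈ ℤ`) and ANY displacement `δ ∈ ℝ⁸` of the symmetric parameters there are `σ, C, ε₁ > 0` with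
  (i) `P(ρδ) − P(0) = ρ·σ` for EVERY admissible scale `ρ` of Lemma B (`σ` = P2's `Σ_b K_b(δ)` = the lane's
  `λ₀·S(t₀; v(δ))`), and (ii) for `0 < ε ≤ ε₁` with `s(a) + εδ` in the closed box,
  **`|phi30 (aOfS (s(a) + εδ)) − phi30 a − (σ/T)·ε·log(1/ε)| ≤ C·ε`**;
* **`phi30_logCusp_openBox`** — on the OPEN box (`0 < s_j < s₀`) hypothesis (ii)'s box condition is automatic
  (`exists_BZBox_perturb`), so the expansion holds for all small `ε > 0`;
* **`phi30_diffQuot_tendsto_of_slope`** — hence (SE-STRUCTURE §3 Cor. 1) the one-sided difference quotient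
  `(Φ(s(a) + εδ) − Φ(s(a)))/ε` tends to `+∞` (`−∞`) as `ε → 0⁺` when `σ > 0` (`σ < 0`): no finite one-sided slope.
Route (lead/lit g27's desk-note decomposition, not the germ reparametrisation): `(0,∞) = ` head period
`+ Σ_{1≤k<K}` periods `+` tail with `K = ⌊ρ/(εT)⌋`; per period the rigid translate `δ_k = εkT·δ` with frozen weight
gives `(P(δ_k) − P(0))/(kT)² = εσ/(kT)` by Lemma B, and `Σ_{k<K} 1/k = log(1/ε) + O(1)`
(`log_le_harmonic_pred_le`); drift, weight freezing, head and tail are each `O(ε)` (part 2/3), the per-period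
errors telescoping (`period_error_le`, `sum_range_inv_mul_succ_le_one`).
READING (numbers, not adjectives): rational directions are LOG-CUSPS of `Φ` in every displacement direction,
with the EXACT coefficient `σ/T`; when `σ ≠ 0` the one-sided difference quotient of `Φ` diverges like
`(σ/T)·log(1/ε)`. NOT here (honest): the size of `C` on a ball of fixed radius (that is the conjectured S-E), the
sign or size of `σ` at any direction (lane / P2 g11 / cert-2 data, not kernel), any statement about `γ`, C2, `ζ(5)`.
-/


noncomputable section

open Set MeasureTheory
open scoped Topology

namespace Summit.KontsevichZagierPeriods.Zeta5Search.Barrier.ConeGamma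

/-! ### The log-cusp expansion of `Φ` -/

/-- The torus-form integrand of `Φ(s(a) + εδ) − Φ(s(a))` is the `savingN`-form one on the box. -/
theorem savingN_perturb_eq_torusN {a : Dir} (δ : Fin 8 → ℝ) (ε u : ℝ) (haε : BZBox (aOfS (sParam a + ε • δ))) :
    savingN (aOfS (sParam a + ε • δ)) u = torusN (u • sParam a + (u * ε) • δ) := by
  rw [savingN_eq_torusN_of_BZBox haε, sParam_aOfS, smul_add, smul_smul]

/-- **THE LOG-CUSP SHAPE THEOREM (P2 g11 `SE-STRUCTURE.md` §3, leading order; kernel form).** Let `a` be a direction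
of the closed box with all 28 forms positive and `T > 0` a period of its orbit (`T·h_k(a) ∈ ℤ`), and let `δ ∈ ℝ⁸`
be ANY displacement of the symmetric parameters. Then there are a slope `σ` and constants `C, ε₁ > 0` such that
* `σ` is the one-sided derivative of the translate integral: `P(ρδ) − P(0) = ρ·σ` for EVERY admissible scale `ρ`
  of Lemma B (`translateIntegral_shift_linear`; P2's `Σ_b K_b(δ)`, the lane's `λ₀·S(t₀; v(δ))`), and
* for all `0 < ε ≤ ε₁` with `s(a) + εδ` still in the closed box,
  **`|Φ(s(a) + εδ) − Φ(s(a)) − (σ/T)·ε·log(1/ε)| ≤ C·ε`**.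
So a rational direction is a LOG-CUSP of `Φ = phi30` in every displacement direction, with the exact coefficient
`σ/T`. Route: the lead's desk-note decomposition (per period `k ≥ 1` the rigid translate `δ_k = εkT·δ` with frozen
weight `(kT)⁻²`, Lemma B below the admissible radius, `Σ_{k<K} 1/k = log(1/ε) + O(1)`), with the drift, the weight
freezing, the head period and the tail each `O(ε)` by the thin-set lemma. NOT here (honest): the size of `C` on a
ball of fixed radius (that is the conjectured lemma S-E), the sign of `σ` at any direction, anything about `γ`. -/
theorem phi30_logCusp {a : Dir} (ha : BZBox a) (hpos : ∀ k, 0 < h28 a k) {T : ℝ} (hT : 0 < T)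
    (hper : ∀ k : Fin 28, ∃ z : ℤ, T * h28 a k = z) (δ : Fin 8 → ℝ) :
    ∃ σ C ε₁ : ℝ, 0 < ε₁ ∧
      (∀ ρ, 0 < ρ → ρ * clusterBound a δ < 1 → ρ * clusterBound a δ < wallDist a T →
        (∀ m, m + 1 < (bkpts a T).card → 2 * ρ * clusterWidth a δ ≤ bkpt a T (m + 1) - bkpt a T m) →
        translateIntegral a T (ρ • δ) - translateIntegral a T 0 = ρ * σ) ∧
      ∀ ε, 0 < ε → ε ≤ ε₁ → BZBox (aOfS (sParam a + ε • δ)) →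
        |phi30 (aOfS (sParam a + ε • δ)) - phi30 a - σ / T * ε * Real.log (1 / ε)| ≤ C * ε := by
  -- the admissible scale and the slope
  obtain ⟨ρ, hρ, h1, h2, hgap⟩ := exists_admissible_scale hpos hT δ
  obtain ⟨σ, hσ⟩ : ∃ σ : ℝ, σ = (translateIntegral a T (ρ • δ) - translateIntegral a T 0) / ρ := ⟨_, rfl⟩
  -- constants (opaque names with defining equations)
  have hY0 : 0 ≤ shiftSize δ := shiftSize_nonneg δ
  have hxm := xMin_pos hpos
  have hxM := xMax_pos hpos
  obtain ⟨C₁, hC₁⟩ : ∃ C₁ : ℝ, C₁ = 392 * shiftSize δ * (T * xMax a + 5) / xMin a := ⟨_, rfl⟩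
  have hC₁nn : 0 ≤ C₁ := by
    rw [hC₁]; exact div_nonneg (mul_nonneg (mul_nonneg (by norm_num) hY0) (by nlinarith)) hxm.le
  obtain ⟨Clog, hClog⟩ : ∃ Clog : ℝ, Clog = 1 + Real.log 2 + |Real.log (ρ / T)| := ⟨_, rfl⟩
  obtain ⟨C, hC⟩ : ∃ C : ℝ, C = (2 * xMax a) ^ 2 * T * C₁ + 4 * C₁ / T + |σ| / T * Clog + 14 / ρ := ⟨_, rfl⟩
  obtain ⟨ε₁, hε₁⟩ : ∃ ε₁ : ℝ,
      ε₁ = min (ρ / (2 * T)) (min (1 / (T * shiftSize δ + 1)) (xMin a / (2 * shiftSize δ + 1))) := ⟨_, rfl⟩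
  have hε₁pos : 0 < ε₁ := by
    rw [hε₁]
    exact lt_min (div_pos hρ (by linarith)) (lt_min (div_pos one_pos (by nlinarith)) (div_pos hxm (by linarith)))
  have hρY : ρ * shiftSize δ ≤ 1 :=
    ((mul_le_mul_of_nonneg_left (shiftSize_le_clusterBound hpos δ) hρ.le).trans h1.le)
  refine ⟨σ, C, ε₁, hε₁pos, fun ρ' hρ' h1' h2' hgap' => ?_, fun ε hε hεle haε => ?_⟩
  · rw [hσ]; exact translateIntegral_sub_eq_mul_slope hpos hT hper δ hρ h1 h2 hgap hρ' h1' h2' hgap'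
  -- the three smallness conditions on ε
  rw [hε₁] at hεle
  have hεa : ε * T ≤ ρ / 2 := by
    have : ε ≤ ρ / (2 * T) := hεle.trans (min_le_left _ _)
    rw [le_div_iff₀ (by linarith)] at this; linarith
  have hεb : ε * T * shiftSize δ ≤ 1 := by
    have h : ε ≤ 1 / (T * shiftSize δ + 1) := hεle.trans ((min_le_right _ _).trans (min_le_left _ _))
    rw [le_div_iff₀ (by nlinarith)] at h
    nlinarith [mul_nonneg hε.le hY0, mul_nonneg (mul_nonneg hε.le hT.le) hY0]
  have hεc : ε * shiftSize δ ≤ xMin a / 2 := by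
    have h : ε ≤ xMin a / (2 * shiftSize δ + 1) := hεle.trans ((min_le_right _ _).trans (min_le_right _ _))
    rw [le_div_iff₀ (by linarith)] at h
    nlinarith [mul_nonneg hε.le hY0]
  -- the number of coherent periods
  obtain ⟨K, hK⟩ : ∃ K : ℕ, K = ⌊ρ / (ε * T)⌋₊ := ⟨_, rfl⟩
  have hεT : 0 < ε * T := mul_pos hε hT
  have hx2 : (2 : ℝ) ≤ ρ / (ε * T) := by rw [le_div_iff₀ hεT]; linarith
  have hK2 : 2 ≤ K := by rw [hK]; exact Nat.le_floor (by exact_mod_cast hx2)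
  have hK2r : (2 : ℝ) ≤ K := by exact_mod_cast hK2
  have hKle : (K : ℝ) ≤ ρ / (ε * T) := by rw [hK]; exact Nat.floor_le (div_nonneg hρ.le hεT.le)
  have hKge : ρ / (ε * T) - 1 ≤ K := by
    have := Nat.lt_floor_add_one (ρ / (ε * T)); rw [← hK] at this; linarith
  have hKT : 0 < (K : ℝ) * T := mul_pos (by linarith) hT
  have hεKT : ε * (K * T) ≤ ρ := by
    have := mul_le_mul_of_nonneg_left hKle hεT.le
    rw [mul_div_cancel₀ _ hεT.ne'] at this; linarith
  -- the integrand in torus form and its integrability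
  obtain ⟨g, hg⟩ : ∃ g : ℝ → ℝ,
      g = fun u => ((torusN (u • sParam a + (u * ε) • δ) : ℝ) - torusN (u • sParam a)) / u ^ 2 := ⟨_, rfl⟩
  have hF : phi30 (aOfS (sParam a + ε • δ)) - phi30 a = ∫ u in Ioi 0, g u := by
    unfold phi30
    rw [← integral_sub (integrableOn_savingN_div_sq haε) (integrableOn_savingN_div_sq ha)]
    refine setIntegral_congr_fun measurableSet_Ioi fun u _ => ?_
    simp only [hg, savingN_perturb_eq_torusN δ ε u haε, savingN_eq_torusN_of_BZBox ha, sub_div]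
  have hgint : IntegrableOn g (Ioi 0) := by
    have h := (integrableOn_savingN_div_sq haε).sub (integrableOn_savingN_div_sq ha)
    refine h.congr_fun (fun u _ => ?_) measurableSet_Ioi
    simp only [hg, Pi.sub_apply, savingN_perturb_eq_torusN δ ε u haε, savingN_eq_torusN_of_BZBox ha, sub_div]
  -- split `(0, ∞) = (0, KT] ∪ (KT, ∞)` and `(0, KT]` into periods
  have hsplit : ∫ u in Ioi 0, g u = (∫ u in (0 : ℝ)..(K * T), g u) + ∫ u in Ioi (K * T), g u := by
    rw [← Ioc_union_Ioi_eq_Ioi hKT.le, setIntegral_union Ioc_disjoint_Ioi_same measurableSet_Ioi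
      (hgint.mono_set Ioc_subset_Ioi_self) (hgint.mono_set (Ioi_subset_Ioi hKT.le)),
      intervalIntegral.integral_of_le hKT.le]
  have hperiods : ∫ u in (0 : ℝ)..(K * T), g u
      = ∑ k ∈ Finset.range K, ∫ u in ((k : ℝ) * T)..(((k : ℝ) + 1) * T), g u := by
    have h := intervalIntegral.sum_integral_adjacent_intervals (a := fun k : ℕ => (k : ℝ) * T) (n := K)
      (f := g) (μ := volume) fun k _ => ?_
    · simp only [Nat.cast_zero, zero_mul] at h
      rw [← h]
      refine Finset.sum_congr rfl fun k _ => ?_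
      push_cast; rfl
    · have hk0 : (0 : ℝ) ≤ k * T := mul_nonneg (Nat.cast_nonneg k) hT.le
      rw [intervalIntegrable_iff_integrableOn_Ioc_of_le (by push_cast; nlinarith)]
      exact hgint.mono_set fun u hu => lt_of_le_of_lt hk0 hu.1
  -- head + coherent periods
  obtain ⟨K', hK'⟩ : ∃ K', K = K' + 1 := ⟨K - 1, by omega⟩
  have hsumsplit : ∑ k ∈ Finset.range K, (∫ u in ((k : ℝ) * T)..(((k : ℝ) + 1) * T), g u)
      = (∑ j ∈ Finset.range K', ∫ u in (((j : ℝ) + 1) * T)..(((j : ℝ) + 1 + 1) * T), g u)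
        + ∫ u in (0 : ℝ)..T, g u := by
    rw [hK', Finset.sum_range_succ']
    simp only [Nat.cast_add, Nat.cast_one, Nat.cast_zero, zero_mul, zero_add, one_mul]
  -- (i) the head
  have hhead : |∫ u in (0 : ℝ)..T, g u| ≤ (2 * xMax a) ^ 2 * ((ε * T) * C₁) := by
    rw [hg, hC₁]
    exact abs_head_integral_le hpos hT δ hε.le hεb hεc
  -- (ii) each coherent period `k = j + 1 ≤ K − 1`
  have hP : ∀ j : ℕ, j < K' →
      |(∫ u in (((j : ℝ) + 1) * T)..(((j : ℝ) + 1 + 1) * T), g u) - ε * σ / (((j : ℝ) + 1) * T)|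
        ≤ (ε * C₁ / T) * (4 / (((j : ℝ) + 1) * ((j : ℝ) + 1 + 1))) := by
    intro j hj
    have hjK : (j : ℝ) + 1 ≤ K := by
      have hj' : (j : ℝ) + 1 ≤ K' := by exact_mod_cast hj
      rw [hK']; push_cast; linarith only [hj']
    have hj1 : ((j : ℝ) + 1) * T ≤ K * T := mul_le_mul_of_nonneg_right hjK hT.le
    have hj0 : (0 : ℝ) < (j : ℝ) + 1 := Nat.cast_add_one_pos j
    have hρ'pos : 0 < ε * (((j : ℝ) + 1) * T) := mul_pos hε (mul_pos hj0 hT)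
    have hρ'le : ε * (((j : ℝ) + 1) * T) ≤ ρ := (mul_le_mul_of_nonneg_left hj1 hε.le).trans hεKT
    have hkY : ε * (((j : ℝ) + 1) * T) * shiftSize δ ≤ 1 :=
      (mul_le_mul_of_nonneg_right hρ'le hY0).trans hρY
    have hper_k := abs_period_integral_sub_translate_le hpos hT hper δ hε.le hεb (k := j + 1) (by omega)
      (by push_cast; exact hkY)
    push_cast at hper_k
    have hB := translateIntegral_shift_eq_slope hpos hT hper δ hρ'pos hρ'le h1 h2 hgap
    rw [← hσ] at hB
    rw [hB, show ε * (((j : ℝ) + 1) * T) * σ / (((j : ℝ) + 1) * T) ^ 2 = ε * σ / (((j : ℝ) + 1) * T) by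
      field_simp] at hper_k
    rw [hg, hC₁]
    have hjnn : (0 : ℝ) ≤ (j : ℝ) := Nat.cast_nonneg j
    exact hper_k.trans (period_error_le hε.le hT (hC₁ ▸ hC₁nn) (by linarith only [hjnn]))
  -- (iii) the sum over the coherent periods against the harmonic number
  have hsum : |(∑ j ∈ Finset.range K', ∫ u in (((j : ℝ) + 1) * T)..(((j : ℝ) + 1 + 1) * T), g u)
      - ε * σ / T * ((harmonic K' : ℚ) : ℝ)| ≤ 4 * (ε * C₁ / T) := by
    rw [harmonic_cast_eq_sum, Finset.mul_sum, ← Finset.sum_sub_distrib]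
    refine (Finset.abs_sum_le_sum_abs _ _).trans ?_
    have hterm : ∀ j ∈ Finset.range K',
        |(∫ u in (((j : ℝ) + 1) * T)..(((j : ℝ) + 1 + 1) * T), g u) - ε * σ / T * (1 / ((j : ℝ) + 1))|
          ≤ (ε * C₁ / T) * (4 / (((j : ℝ) + 1) * ((j : ℝ) + 1 + 1))) := by
      intro j hj
      rw [show ε * σ / T * (1 / ((j : ℝ) + 1)) = ε * σ / (((j : ℝ) + 1) * T) by field_simp]
      exact hP j (Finset.mem_range.mp hj)
    refine (Finset.sum_le_sum hterm).trans ?_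
    rw [← Finset.mul_sum]
    have h4 : ∑ j ∈ Finset.range K', 4 / (((j : ℝ) + 1) * ((j : ℝ) + 1 + 1))
        = 4 * ∑ j ∈ Finset.range K', 1 / (((j : ℝ) + 1) * ((j : ℝ) + 2)) := by
      rw [Finset.mul_sum]
      refine Finset.sum_congr rfl fun j _ => ?_
      rw [show (j : ℝ) + 1 + 1 = (j : ℝ) + 2 by ring]
      field_simp
    rw [h4]
    have hs := sum_range_inv_mul_succ_le_one K'
    have hpos' : 0 ≤ ε * C₁ / T := div_nonneg (mul_nonneg hε.le hC₁nn) hT.le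
    have := mul_le_mul_of_nonneg_left hs hpos'
    linarith only [this]
  -- (iv) the tail
  have htail : |∫ u in Ioi ((K : ℝ) * T), g u| ≤ 14 * ε / ρ := by
    rw [hg]
    refine (abs_tail_integral_le a δ ε hKT).trans ?_
    have hKT2 : ρ / (2 * ε) ≤ K * T := by
      have h : ρ / (ε * T) / 2 ≤ K := by linarith only [hKge, hx2]
      have := mul_le_mul_of_nonneg_right h hT.le
      calc ρ / (2 * ε) = ρ / (ε * T) / 2 * T := by field_simp
        _ ≤ K * T := this
    calc 7 / ((K : ℝ) * T) ≤ 7 / (ρ / (2 * ε)) :=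
          div_le_div_of_nonneg_left (by norm_num) (div_pos hρ (by linarith only [hε])) hKT2
      _ = 14 * ε / ρ := by field_simp; ring
  -- (v) harmonic number against `log (1/ε)`
  have hlog : |((harmonic K' : ℚ) : ℝ) - Real.log (1 / ε)| ≤ Clog := by
    have hKK : K - 1 = K' := by omega
    obtain ⟨hl, hu⟩ := log_le_harmonic_pred_le hK2
    rw [hKK] at hl hu
    have hKpos : (0 : ℝ) < K := by linarith only [hK2r]
    have hlogK_le : Real.log K ≤ Real.log (1 / ε) + Real.log (ρ / T) := by
      have h := Real.log_le_log hKpos hKle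
      rw [Real.log_div hρ.ne' hεT.ne', Real.log_mul hε.ne' hT.ne'] at h
      rw [Real.log_div one_ne_zero hε.ne', Real.log_one, Real.log_div hρ.ne' hT.ne']
      linarith only [h]
    have hlogK_ge : Real.log (1 / ε) + Real.log (ρ / T) - Real.log 2 ≤ Real.log K := by
      have hx : ρ / (ε * T) / 2 ≤ K := by linarith only [hKge, hx2]
      have h := Real.log_le_log (div_pos (div_pos hρ hεT) two_pos) hx
      rw [Real.log_div (div_pos hρ hεT).ne' two_ne_zero, Real.log_div hρ.ne' hεT.ne',
        Real.log_mul hε.ne' hT.ne'] at h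
      rw [Real.log_div one_ne_zero hε.ne', Real.log_one, Real.log_div hρ.ne' hT.ne']
      linarith only [h]
    have hlog2 : 0 < Real.log 2 := Real.log_pos one_lt_two
    rw [hClog, abs_le]
    constructor
    · have h := neg_abs_le (Real.log (ρ / T)); linarith only [h, hl, hlogK_ge, hlog2]
    · have h := le_abs_self (Real.log (ρ / T)); linarith only [h, hu, hlogK_le, hlog2]
  -- (vi) assemble: a purely algebraic combination of (i)–(v)
  have key : ∀ I₀ S Tl H Λ : ℝ, |I₀| ≤ (2 * xMax a) ^ 2 * ((ε * T) * C₁) →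
      |S - ε * σ / T * H| ≤ 4 * (ε * C₁ / T) → |Tl| ≤ 14 * ε / ρ → |H - Λ| ≤ Clog →
      |S + I₀ + Tl - σ / T * ε * Λ| ≤ C * ε := by
    intro I₀ S Tl H Λ hI hS hTl hH
    have hdecomp : S + I₀ + Tl - σ / T * ε * Λ = I₀ + (S - ε * σ / T * H) + ε * σ / T * (H - Λ) + Tl := by
      ring
    have hmid : |ε * σ / T * (H - Λ)| ≤ ε * (|σ| / T * Clog) := by
      rw [abs_mul, show |ε * σ / T| = ε * (|σ| / T) by
        rw [abs_div, abs_mul, abs_of_pos hε, abs_of_pos hT]; ring]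
      rw [mul_assoc]
      exact mul_le_mul_of_nonneg_left (mul_le_mul_of_nonneg_left hH (div_nonneg (abs_nonneg σ) hT.le)) hε.le
    rw [hdecomp]
    calc |I₀ + (S - ε * σ / T * H) + ε * σ / T * (H - Λ) + Tl|
        ≤ |I₀| + |S - ε * σ / T * H| + |ε * σ / T * (H - Λ)| + |Tl| :=
          (abs_add_le _ _).trans (add_le_add ((abs_add_le _ _).trans
            (add_le_add (abs_add_le _ _) le_rfl)) le_rfl)
      _ ≤ (2 * xMax a) ^ 2 * ((ε * T) * C₁) + 4 * (ε * C₁ / T) + ε * (|σ| / T * Clog) + 14 * ε / ρ :=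
          add_le_add (add_le_add (add_le_add hI hS) hmid) hTl
      _ = C * ε := by rw [hC]; field_simp
  rw [hF, hsplit, hperiods, hsumsplit]
  exact key (∫ u in (0 : ℝ)..T, g u)
    (∑ j ∈ Finset.range K', ∫ u in (((j : ℝ) + 1) * T)..(((j : ℝ) + 1 + 1) * T), g u)
    (∫ u in Ioi ((K : ℝ) * T), g u) ((harmonic K' : ℚ) : ℝ) (Real.log (1 / ε)) hhead hsum htail hlog


/-! ### The open box: the perturbed direction stays in the box, so the expansion is unconditional there -/

/-- On the OPEN box (`0 < s_j < s₀` for `j = 1..7`) all 28 forms are positive. -/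
theorem h28_pos_of_openBox {a : Dir} (hj : ∀ j : Fin 7, 0 < sParam a j.succ ∧ sParam a j.succ < sParam a 0)
    (k : Fin 28) : 0 < h28 a k := by
  obtain ⟨h1a, h1b⟩ := hj 0
  obtain ⟨h2a, h2b⟩ := hj 1
  obtain ⟨h3a, h3b⟩ := hj 2
  obtain ⟨h4a, h4b⟩ := hj 3
  obtain ⟨h5a, h5b⟩ := hj 4
  obtain ⟨h6a, h6b⟩ := hj 5
  obtain ⟨h7a, h7b⟩ := hj 6
  simp only [Fin.succ_zero_eq_one] at h1a h1b
  change 0 < sParam a 2 at h2a; change sParam a 2 < sParam a 0 at h2b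
  change 0 < sParam a 3 at h3a; change sParam a 3 < sParam a 0 at h3b
  change 0 < sParam a 4 at h4a; change sParam a 4 < sParam a 0 at h4b
  change 0 < sParam a 5 at h5a; change sParam a 5 < sParam a 0 at h5b
  change 0 < sParam a 6 at h6a; change sParam a 6 < sParam a 0 at h6b
  change 0 < sParam a 7 at h7a; change sParam a 7 < sParam a 0 at h7b
  rw [← aOfS_sParam a, h28_aOfS]
  fin_cases k <;> simp <;> linarith

/-- The open box lies in the closed box. -/
theorem BZBox_of_openBox {a : Dir} (hj : ∀ j : Fin 7, 0 < sParam a j.succ ∧ sParam a j.succ < sParam a 0) :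
    BZBox a :=
  ⟨(hj 0).1.trans (hj 0).2, fun j => ⟨(hj j).1.le, (hj j).2.le⟩⟩

/-- **Small perturbations of an open-box direction stay in the closed box**: there is `ε₂ > 0` with
`aOfS (s(a) + ε·δ)` in the box for all `0 ≤ ε ≤ ε₂`. -/
theorem exists_BZBox_perturb {a : Dir} (hj : ∀ j : Fin 7, 0 < sParam a j.succ ∧ sParam a j.succ < sParam a 0)
    (δ : Fin 8 → ℝ) : ∃ ε₂ : ℝ, 0 < ε₂ ∧ ∀ ε, 0 ≤ ε → ε ≤ ε₂ → BZBox (aOfS (sParam a + ε • δ)) := by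
  -- the margin `m` of the open box and the size `D` of the displacement
  obtain ⟨m, hm, hms, hms0⟩ : ∃ m : ℝ, 0 < m ∧ (∀ j : Fin 7, m ≤ sParam a j.succ) ∧
      ∀ j : Fin 7, m ≤ sParam a 0 - sParam a j.succ := by
    refine ⟨(Finset.univ : Finset (Fin 7)).inf' Finset.univ_nonempty fun j =>
      min (sParam a j.succ) (sParam a 0 - sParam a j.succ), ?_, fun j => ?_, fun j => ?_⟩
    · rw [Finset.lt_inf'_iff]
      exact fun j _ => lt_min (hj j).1 (sub_pos.mpr (hj j).2)
    · exact (Finset.inf'_le _ (Finset.mem_univ j)).trans (min_le_left _ _)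
    · exact (Finset.inf'_le _ (Finset.mem_univ j)).trans (min_le_right _ _)
  obtain ⟨D, hD0, hD⟩ : ∃ D : ℝ, 0 ≤ D ∧ ∀ i : Fin 8, |δ i| ≤ D :=
    ⟨(Finset.univ : Finset (Fin 8)).sup' Finset.univ_nonempty fun i => |δ i|,
      (abs_nonneg (δ 0)).trans (Finset.le_sup' (fun i => |δ i|) (Finset.mem_univ 0)),
      fun i => Finset.le_sup' (fun i => |δ i|) (Finset.mem_univ i)⟩
  refine ⟨m / (2 * D + 1), div_pos hm (by linarith), fun ε hε0 hεle => ?_⟩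
  have hsmall : ∀ i : Fin 8, |ε * δ i| ≤ m / 2 := by
    intro i
    rw [abs_mul, abs_of_nonneg hε0]
    calc ε * |δ i| ≤ m / (2 * D + 1) * D := mul_le_mul hεle (hD i) (abs_nonneg _) (by positivity)
      _ ≤ m / 2 := by
          rw [div_mul_eq_mul_div, div_le_div_iff₀ (by linarith) two_pos]
          nlinarith
  have hs1 : m ≤ sParam a 1 := hms 0
  have hs10 : sParam a 1 < sParam a 0 := (hj 0).2
  unfold BZBox
  rw [sParam_aOfS]
  simp only [Pi.add_apply, Pi.smul_apply, smul_eq_mul]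
  have h0 := abs_le.mp (hsmall 0)
  refine ⟨by linarith, fun j => ⟨?_, ?_⟩⟩
  · have := abs_le.mp (hsmall j.succ); have := hms j; linarith
  · have := abs_le.mp (hsmall j.succ); have := hms0 j; linarith

/-- **The log-cusp expansion on the OPEN box** (no hypothesis on the perturbed direction): for `a` with
`0 < s_j(a) < s₀(a)` (`j = 1..7`), a period `T`, and any `δ ∈ ℝ⁸`, there are `σ, C, ε₁ > 0` with the slope `σ`
characterised as in `phi30_logCusp` and
`|Φ(s(a) + εδ) − Φ(s(a)) − (σ/T)·ε·log(1/ε)| ≤ C·ε` for all `0 < ε ≤ ε₁`. -/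
theorem phi30_logCusp_openBox {a : Dir} (hopen : ∀ j : Fin 7, 0 < sParam a j.succ ∧ sParam a j.succ < sParam a 0)
    {T : ℝ} (hT : 0 < T) (hper : ∀ k : Fin 28, ∃ z : ℤ, T * h28 a k = z) (δ : Fin 8 → ℝ) :
    ∃ σ C ε₁ : ℝ, 0 < ε₁ ∧
      (∀ ρ, 0 < ρ → ρ * clusterBound a δ < 1 → ρ * clusterBound a δ < wallDist a T →
        (∀ m, m + 1 < (bkpts a T).card → 2 * ρ * clusterWidth a δ ≤ bkpt a T (m + 1) - bkpt a T m) →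
        translateIntegral a T (ρ • δ) - translateIntegral a T 0 = ρ * σ) ∧
      ∀ ε, 0 < ε → ε ≤ ε₁ →
        |phi30 (aOfS (sParam a + ε • δ)) - phi30 a - σ / T * ε * Real.log (1 / ε)| ≤ C * ε := by
  obtain ⟨σ, C, ε₁, hε₁, hslope, hexp⟩ :=
    phi30_logCusp (BZBox_of_openBox hopen) (h28_pos_of_openBox hopen) hT hper δ
  obtain ⟨ε₂, hε₂, hbox⟩ := exists_BZBox_perturb hopen δ
  exact ⟨σ, C, min ε₁ ε₂, lt_min hε₁ hε₂, hslope, fun ε hε hεle =>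
    hexp ε hε (hεle.trans (min_le_left _ _)) (hbox ε hε.le (hεle.trans (min_le_right _ _)))⟩


/-- **Log-cusp, literal form (SE-STRUCTURE §3 Cor. 1 in the kernel).** On the open box, with `σ` the slope of
`phi30_logCusp`: if `σ > 0` the one-sided difference quotient `(Φ(s(a) + εδ) − Φ(s(a)))/ε` tends to `+∞` as
`ε → 0⁺`, and if `σ < 0` it tends to `−∞` — `Φ` has NO finite one-sided derivative at a rational direction in any
displacement direction with non-zero slope (N1b's «one-sided slopes grow like `ln(1/ε)`»). The sign of `σ` at any
particular direction is NOT decided here. -/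
theorem phi30_diffQuot_tendsto_of_slope {a : Dir}
    (hopen : ∀ j : Fin 7, 0 < sParam a j.succ ∧ sParam a j.succ < sParam a 0)
    {T : ℝ} (hT : 0 < T) (hper : ∀ k : Fin 28, ∃ z : ℤ, T * h28 a k = z) (δ : Fin 8 → ℝ) :
    ∃ σ : ℝ,
      (∀ ρ, 0 < ρ → ρ * clusterBound a δ < 1 → ρ * clusterBound a δ < wallDist a T →
        (∀ m, m + 1 < (bkpts a T).card → 2 * ρ * clusterWidth a δ ≤ bkpt a T (m + 1) - bkpt a T m) →
        translateIntegral a T (ρ • δ) - translateIntegral a T 0 = ρ * σ) ∧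
      (0 < σ → Filter.Tendsto (fun ε => (phi30 (aOfS (sParam a + ε • δ)) - phi30 a) / ε)
        (𝓝[>] 0) Filter.atTop) ∧
      (σ < 0 → Filter.Tendsto (fun ε => (phi30 (aOfS (sParam a + ε • δ)) - phi30 a) / ε)
        (𝓝[>] 0) Filter.atBot) := by
  obtain ⟨σ, C, ε₁, hε₁, hslope, hexp⟩ := phi30_logCusp_openBox hopen hT hper δ
  have hlog : Filter.Tendsto (fun ε : ℝ => Real.log (1 / ε)) (𝓝[>] 0) Filter.atTop := by
    refine (Filter.tendsto_neg_atBot_atTop.comp Real.tendsto_log_nhdsGT_zero).congr' ?_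
    filter_upwards [self_mem_nhdsWithin] with ε _
    simp [Real.log_inv]
  refine ⟨σ, hslope, fun hσ => ?_, fun hσ => ?_⟩
  · have hev : ∀ᶠ ε in 𝓝[>] (0 : ℝ),
        σ / T * Real.log (1 / ε) + -C ≤ (phi30 (aOfS (sParam a + ε • δ)) - phi30 a) / ε := by
      filter_upwards [Ioo_mem_nhdsGT hε₁] with ε hε
      have h := (abs_le.mp (hexp ε hε.1 hε.2.le)).1
      rw [le_div_iff₀ hε.1]
      linarith
    exact Filter.tendsto_atTop_mono' _ hev
      (Filter.tendsto_atTop_add_const_right _ (-C) (hlog.const_mul_atTop (div_pos hσ hT)))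
  · have hev : ∀ᶠ ε in 𝓝[>] (0 : ℝ),
        (phi30 (aOfS (sParam a + ε • δ)) - phi30 a) / ε ≤ σ / T * Real.log (1 / ε) + C := by
      filter_upwards [Ioo_mem_nhdsGT hε₁] with ε hε
      have h := (abs_le.mp (hexp ε hε.1 hε.2.le)).2
      rw [div_le_iff₀ hε.1]
      linarith
    exact Filter.tendsto_atBot_mono' _ hev
      (Filter.tendsto_atBot_add_const_right _ C (hlog.const_mul_atTop_of_neg (div_neg_of_neg_of_pos hσ hT)))

end Summit.KontsevichZagierPeriods.Zeta5Search.Barrier.ConeGamma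

end
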